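import Literature.AnabelianGeometry.EtaleTheta.Discharge.Sec2BiThetaSystemsProofs
import Literature.AnabelianGeometry.EtaleTheta.Discharge.Sec2AutOverProofs
import Literature.AnabelianGeometry.EtaleTheta.Discharge.Sec2DescentLemmas
import Mathlib.GroupTheory.GroupAction.ConjAct

/-!
# [EtTh] §2 discharge: Corollary 2.16 (profinite non-discreteness of bi-theta environments) —
# proof-only companion of `ThetaSystems.lean`

Mochizuki, *The Étale Theta Function and its Frobenioid-theoretic Manifestations* [EtTh],
Publ. RIMS 45 (2009), §2, Cor 2.16 pp.53–54, proof p.54: "In light of the symmetries of bi-theta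
environments [cf. Proposition 2.14, (iii)], Corollary 2.16 follows immediately from Proposition 2.15,
(iii)"; Prop 2.14 (iii), bi-theta case, proof p.50: "if … `t^Θ_Ÿ` is obtained as an
`N·(l·ℤ)`-conjugate of `s^Θ_Ÿ`, then the cocycle `δ` is a coboundary; in particular, [in this case]
the automorphism `α_δ` preserves the `μ_N`-conjugacy classes of subgroups determined by the images of
`s^Θ_Ÿ`, `t^Θ_Ÿ`, `s^alg_Ÿ`. This shows that `Im_N ⊇ (N·l·ℤ) ⋊ {±1}`" (locators `p.N` = PDF pages of the
PRIMS text; bib key `MochizukiEtTh2009`).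

PROOF-ONLY companion (no `def`, no new named fact; seat abc-iut-L2-t2, DAG node `EtTh:Cor2.16`) of
`ThetaSystems.lean` (same seat; nothing there is edited or restated). `ThetaEnvTower.cor216_of` — the
named fact `ThetaEnvTower.Cor216` HOLDS for every tower in which
* `Π^tp_Ÿ ↠ G_K` (`haug`; the interface axiom `RigidData.augYdd_surjective` of `ThetaRigidity.lean`,
  p.41 "`K = K̈`", which the tower `ThetaEnvTower` does not carry), and
* the printed bi-theta symmetry clause of Prop 2.14 (iii) holds in cocycle form (`hshift`): for
  `x ∈ Π^tp_X` whose image in `Gal(Y/X) ≅ ℤ` (`galYX`; print's `l·ℤ`, generator `↔ l`) is divisible by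
  the level `M`, the `x`-conjugate of a mod-`M` theta cocycle `η` (`conjCocycle`, i.e. the cocycle of the
  `(l·ℤ)`-conjugate section `t^Θ`) differs from `η` by a COBOUNDARY ("`δ` is a coboundary") — in the
  model a consequence of Prop 1.5 (iii) (the `ℤ`-action on `η̈^Θ` changes the class by Kummer classes
  of `Ü^{2k} q^{k²}`-type terms, which die mod `M` when `M ∣ k`); it is NOT derivable from the tower
  axioms, hence an explicit binder.
Route = the printed one made explicit (Prop 2.15 (iii)'s construction transported by the symmetries):
choose `x₁ ∈ Π^tp_X` generating `Gal(Y/X)` with `aug x₁ = 1` (possible by `haug`), integers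
`k_M ≡ j_M (mod M)` with `k_1 = 0`; put `γ_{M',M} := conj(x₁^{k_{M'} − k_M}) ∘ β_{M',M}` — a projective
system since the conjugations commute with the reductions; (a) `conj(x₁^{k_{M'}−k_M})` IS an
automorphism of the model bi-theta environment `B_M` because `M ∣ k_{M'} − k_M` (`hshift` +
`μ_M`-conjugacy bookkeeping), and `α' = id`; (b) `γ_{M,1}` carries `s^Θ_M(g)` to `s^alg_1(x_M g x_M⁻¹)`,
`x_M := x₁^{k_M}`, and the transported difference cocycle `η_M(x_M⁻¹ g x_M)` IS the `x_M`-conjugate of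
`η_M` on the nose (`aug x_M = 1`, coboundary `c = 1`). HONEST FRAMING: conditional discharge modulo the
two printed inputs named; no side is taken on [IUTchIII] Cor 3.12; typed ≠ discharged elsewhere.
-/

namespace Literature.AnabelianGeometry.EtaleTheta

universe u

/-! ## Bookkeeping on the cyclotomic envelope -/

/-- Conjugating a subgroup by an element of the cyclotome does not change its `μ`-conjugacy class
(same content as abc-iut-L2-t10's `CycEnvelope.muConjClass_map_conj_inMu`, whose module is not an
import here). [cite: MochizukiEtTh2009, Def 2.10 p.44] -/
private theorem muConjClass_map_conj_inMu' {P G μ : Type*} [Group P] [Group G] [CommGroup μ]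
    (aug : P →* G) (χ : G →* MulAut μ) (H : Subgroup (CycEnvelope aug χ)) (m : μ) :
    CycEnvelope.muConjClass aug χ (H.map (MulAut.conj (CycEnvelope.inMu aug χ m)).toMonoidHom) =
      CycEnvelope.muConjClass aug χ H := by
  have key : ∀ a b : μ,
      (H.map (MulAut.conj (CycEnvelope.inMu aug χ b)).toMonoidHom).map
          (MulAut.conj (CycEnvelope.inMu aug χ a)).toMonoidHom =
        H.map (MulAut.conj (CycEnvelope.inMu aug χ (a * b))).toMonoidHom := by
    intro a b
    rw [Subgroup.map_map]
    congr 1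
    refine MonoidHom.ext fun x => ?_
    simp only [MonoidHom.coe_comp, Function.comp_apply, MulEquiv.coe_toMonoidHom,
      MulAut.conj_apply, map_mul, MulAut.mul_apply, mul_assoc]
  ext K
  constructor
  · rintro ⟨a, rfl⟩
    exact ⟨a * m, key a m⟩
  · rintro ⟨a, rfl⟩
    refine ⟨a * m⁻¹, ?_⟩
    rw [key, inv_mul_cancel_right]

/-- Rearrangement in a commutative group: `(e · (c · (s c)⁻¹))⁻¹ = e⁻¹ · (c⁻¹ · (s c⁻¹)⁻¹)` (the
inverse of "cocycle times coboundary of `c`" is "inverse cocycle times coboundary of `c⁻¹`").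
[cite: MochizukiEtTh2009, p.47] -/
theorem inv_mul_coboundary_eq {A : Type*} [CommGroup A] (s : MulAut A) (e c : A) :
    (e * (c * (s c)⁻¹))⁻¹ = e⁻¹ * (c⁻¹ * (s c⁻¹)⁻¹) := by
  rw [map_inv, inv_inv, mul_inv_rev, mul_inv_rev, inv_inv]
  simp only [mul_comm]

namespace ThetaEnvTower

variable {E : Set ℕ+} (T : ThetaEnvTower.{u} E)

/-! ## The `Gal(Y/X)`-conjugations `conjX g` on the model bi-theta environments -/

/-- `conjX 1 = id`. [cite: MochizukiEtTh2009, Def 2.13(i) p.47] -/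
theorem conjX_one (M : E) : (T.level M).conjX 1 = 1 := by
  apply MulEquiv.ext
  intro x
  rw [MulAut.one_apply]
  ext
  · simp [ThetaEnvData.conjX]
  · simp [ThetaEnvData.conjX]

/-- `conjX g` maps the cyclotome onto itself: `conjX g (ι a) = ι(χ(aug g) a)`.
[cite: MochizukiEtTh2009, Def 2.13(i) p.47] -/
theorem conjX_inMu (M : E) (g : T.PiX) (a : T.mu M) :
    (T.level M).conjX g (CycEnvelope.inMu (T.level M).augY (T.level M).chi a) =
      CycEnvelope.inMu (T.level M).augY (T.level M).chi ((T.level M).chi (T.aug g) a) := by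
  ext
  · simp [ThetaEnvData.conjX]
  · simp [ThetaEnvData.conjX]

/-- `conjX g` on the algebraic section: `conjX g (s^alg(k)) = s^alg(g k g⁻¹)`.
[cite: MochizukiEtTh2009, Def 2.13(i) p.47] -/
theorem conjX_sAlg (M : E) (g : T.PiX) (k : T.PiYdd) :
    (T.level M).conjX g ((T.level M).sAlg k) =
      (T.level M).sAlg ⟨g * k * g⁻¹, T.PiYdd_normal.conj_mem _ k.2 g⟩ := by
  ext
  · simp [ThetaEnvData.conjX, ThetaEnvData.sAlg]
  · rfl

/-- `conjX g` stabilises the image of the algebraic section (`Π^tp_Ÿ` is normal in `Π^tp_X`).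
[cite: MochizukiEtTh2009, Def 2.13(iii) p.48] -/
theorem map_range_sAlg_conjX (M : E) (g : T.PiX) :
    (T.level M).sAlg.range.map ((T.level M).conjX g).toMonoidHom = (T.level M).sAlg.range := by
  ext z
  constructor
  · rintro ⟨_, ⟨k, rfl⟩, rfl⟩
    exact ⟨⟨g * k * g⁻¹, T.PiYdd_normal.conj_mem _ k.2 g⟩, (T.conjX_sAlg M g k).symm⟩
  · rintro ⟨k, rfl⟩
    refine ⟨(T.level M).sAlg ⟨g⁻¹ * k * g⁻¹⁻¹, T.PiYdd_normal.conj_mem _ k.2 g⁻¹⟩, ⟨_, rfl⟩, ?_⟩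
    change (T.level M).conjX g _ = _
    rw [T.conjX_sAlg M g]
    congr 1
    apply Subtype.ext
    change g * (g⁻¹ * (k : T.PiX) * g⁻¹⁻¹) * g⁻¹ = k
    group

/-- **The bi-theta symmetry clause in use**: if the `g`-conjugate of the theta cocycle `η` is `η` times
the coboundary of `c`, then `conjX g` carries `s^Θ_η(g⁻¹ k g)` to the `μ`-conjugate
`ι(c⁻¹) s^Θ_η(k) ι(c⁻¹)⁻¹` of `s^Θ_η(k)` ("conjugation by `α_δ` maps `s^Θ` to `t^Θ`", `δ` a coboundary).
[cite: MochizukiEtTh2009, Prop 2.14(iii) p.50] -/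
theorem conjX_sTheta_of_conjCocycle (M : E) {η : T.PiYdd → T.mu M} (hη : η ∈ T.thetaCocycles M)
    (g : T.PiX) (c : T.mu M)
    (hc : T.conjCocycle M g η = η * CycEnvelope.coboundary (T.aug.comp T.PiYdd.subtype) (T.chi M) c)
    (k : T.PiYdd) :
    (T.level M).conjX g ((T.level M).sTheta hη ⟨g⁻¹ * k * g, by
        simpa [mul_assoc] using T.PiYdd_normal.conj_mem _ k.2 g⁻¹⟩) =
      MulAut.conj (CycEnvelope.inMu (T.level M).augY (T.level M).chi c⁻¹)
        ((T.level M).sTheta hη k) := by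
  have hk := congrFun hc k
  rw [Pi.mul_apply] at hk
  ext
  · have hL : ((T.level M).conjX g ((T.level M).sTheta hη ⟨g⁻¹ * k * g, by
          simpa [mul_assoc] using T.PiYdd_normal.conj_mem _ k.2 g⁻¹⟩)).left =
        (T.conjCocycle M g η k)⁻¹ := by
      change (T.level M).chi ((T.level M).aug g) (η _)⁻¹ = _
      rw [map_inv]
      rfl
    have hR : (MulAut.conj (CycEnvelope.inMu (T.level M).augY (T.level M).chi c⁻¹)
        ((T.level M).sTheta hη k)).left =
        (η k)⁻¹ * CycEnvelope.coboundary (T.aug.comp T.PiYdd.subtype) (T.chi M) c⁻¹ k := by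
      rw [CycEnvelope.conj_inMu_eq_shift_coboundary]
      rfl
    rw [hL, hR, hk]
    exact inv_mul_coboundary_eq ((T.chi M) ((T.aug.comp T.PiYdd.subtype) k)) (η k) c
  · change g * (g⁻¹ * (k : T.PiX) * g) * g⁻¹ = _
    rw [CycEnvelope.conj_inMu_eq_shift_coboundary]
    change _ = (k : T.PiX)
    group

/-- Hence `conjX g` carries the image of `s^Θ_η` onto a `μ`-conjugate of it.
[cite: MochizukiEtTh2009, Prop 2.14(iii) p.50] -/
theorem map_range_sTheta_conjX (M : E) {η : T.PiYdd → T.mu M} (hη : η ∈ T.thetaCocycles M)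
    (g : T.PiX) (c : T.mu M)
    (hc : T.conjCocycle M g η = η * CycEnvelope.coboundary (T.aug.comp T.PiYdd.subtype) (T.chi M) c) :
    ((T.level M).sTheta hη).range.map ((T.level M).conjX g).toMonoidHom =
      ((T.level M).sTheta hη).range.map
        (MulAut.conj (CycEnvelope.inMu (T.level M).augY (T.level M).chi c⁻¹)).toMonoidHom := by
  ext z
  constructor
  · rintro ⟨_, ⟨h, rfl⟩, rfl⟩
    let k : T.PiYdd := ⟨g * h * g⁻¹, T.PiYdd_normal.conj_mem _ h.2 g⟩
    have e : (T.level M).sTheta hη ⟨g⁻¹ * k * g, by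
        simpa [mul_assoc] using T.PiYdd_normal.conj_mem _ k.2 g⁻¹⟩ = (T.level M).sTheta hη h :=
      congrArg _ (Subtype.ext (by change g⁻¹ * (g * (h : T.PiX) * g⁻¹) * g = h; group))
    refine ⟨(T.level M).sTheta hη k, ⟨k, rfl⟩, ?_⟩
    change MulAut.conj _ _ = (T.level M).conjX g ((T.level M).sTheta hη h)
    rw [← e, T.conjX_sTheta_of_conjCocycle M hη g c hc k]
  · rintro ⟨_, ⟨k, rfl⟩, rfl⟩
    exact ⟨(T.level M).sTheta hη ⟨g⁻¹ * k * g, by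
        simpa [mul_assoc] using T.PiYdd_normal.conj_mem _ k.2 g⁻¹⟩, ⟨_, rfl⟩,
      T.conjX_sTheta_of_conjCocycle M hη g c hc k⟩

/-! ## Automorphisms of the model bi-theta environments -/

/-- The identity is an automorphism of the model bi-theta environment `B_M`.
[cite: MochizukiEtTh2009, Def 2.13(iii) p.48] -/
theorem exists_biIso_refl (M : E) {η : T.PiYdd → T.mu M} (hη : η ∈ T.thetaCocycles M) :
    ∃ α : ((T.level M).modelBi hη).Iso ((T.level M).modelBi hη), ∀ x, α.e x = x := by
  have ht : TopOut.transport (ContinuousMulEquiv.refl (T.level M).env) = MonoidHom.id _ := by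
    ext ⟨φ⟩; rfl
  have hid : (fun H : Subgroup (T.level M).env =>
      H.map (ContinuousMulEquiv.refl (T.level M).env).toMulEquiv.toMonoidHom) = id := by
    funext H; exact Subgroup.map_id H
  refine ⟨{ e := ContinuousMulEquiv.refl _, map_D := ?_, map_sTheta := ?_, map_sAlg := ?_ },
    fun x => rfl⟩
  · change (T.level M).DY.map (TopOut.transport (ContinuousMulEquiv.refl (T.level M).env)) = _
    rw [ht]; exact Subgroup.map_id _
  · change (fun H : Subgroup (T.level M).env =>
      H.map (ContinuousMulEquiv.refl (T.level M).env).toMulEquiv.toMonoidHom) '' _ = _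
    rw [hid, Set.image_id]
  · change (fun H : Subgroup (T.level M).env =>
      H.map (ContinuousMulEquiv.refl (T.level M).env).toMulEquiv.toMonoidHom) '' _ = _
    rw [hid, Set.image_id]

/-- **Prop 2.14 (iii), bi-theta case, in use**: for `g ∈ Π^tp_X` whose conjugate of `η` is `η` times a
coboundary, `conjX g` IS an automorphism of the model bi-theta environment `B_M(η)` — it normalises
`D_Y` (its class lies in `D_Y`), permutes the cyclotome, carries `[Im s^Θ_η]` to itself (by the
coboundary) and `[Im s^alg]` to itself. [cite: MochizukiEtTh2009, Prop 2.14(iii) p.50] -/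
theorem exists_biIso_conjX (M : E) {η : T.PiYdd → T.mu M} (hη : η ∈ T.thetaCocycles M)
    (g : T.PiX) (c : T.mu M)
    (hc : T.conjCocycle M g η = η * CycEnvelope.coboundary (T.aug.comp T.PiYdd.subtype) (T.chi M) c) :
    ∃ α : ((T.level M).modelBi hη).Iso ((T.level M).modelBi hη),
      ∀ x, α.e x = (T.level M).conjX g x := by
  let κ : contMulAut (T.level M).env := ⟨(T.level M).conjX g, (T.level M).conjX_mem_contMulAut g⟩
  have hμ : ∀ a : T.mu M, ∃ b : T.mu M, (κ : MulAut (T.level M).env)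
      (CycEnvelope.inMu (T.level M).augY (T.level M).chi a) =
        CycEnvelope.inMu (T.level M).augY (T.level M).chi b :=
    fun a => ⟨_, T.conjX_inMu M g a⟩
  have hμ' : ∀ b : T.mu M, ∃ a : T.mu M, (κ : MulAut (T.level M).env)
      (CycEnvelope.inMu (T.level M).augY (T.level M).chi a) =
        CycEnvelope.inMu (T.level M).augY (T.level M).chi b := fun b =>
    ⟨((T.level M).chi (T.aug g))⁻¹ b, by
      change (T.level M).conjX g _ = _
      rw [T.conjX_inMu M g, MulAut.apply_inv_self]⟩
  refine ⟨{ e := ContinuousMulEquiv.mk (κ : MulAut (T.level M).env) κ.2.1 κ.2.2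
            map_D := ?_, map_sTheta := ?_, map_sAlg := ?_ }, fun x => rfl⟩
  · change (T.level M).DY.map (TopOut.transport _) = (T.level M).DY
    rw [TopOut.transport_mk_eq_conj]
    exact T.map_conj_DY_eq M ((T.level M).mk_conjX_mem_DY g)
  · change (fun H : Subgroup (T.level M).env => H.map (κ : MulAut (T.level M).env).toMonoidHom) ''
        CycEnvelope.muConjClass (T.level M).augY (T.level M).chi ((T.level M).sTheta hη).range =
      CycEnvelope.muConjClass (T.level M).augY (T.level M).chi ((T.level M).sTheta hη).range
    rw [CycEnvelope.image_muConjClass_eq_of_perm _ _ _ hμ hμ']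
    change CycEnvelope.muConjClass (T.level M).augY (T.level M).chi
        (((T.level M).sTheta hη).range.map ((T.level M).conjX g).toMonoidHom) = _
    rw [T.map_range_sTheta_conjX M hη g c hc, muConjClass_map_conj_inMu']
  · change (fun H : Subgroup (T.level M).env => H.map (κ : MulAut (T.level M).env).toMonoidHom) ''
        CycEnvelope.muConjClass (T.level M).augY (T.level M).chi (T.level M).sAlg.range =
      CycEnvelope.muConjClass (T.level M).augY (T.level M).chi (T.level M).sAlg.range
    rw [CycEnvelope.image_muConjClass_eq_of_perm _ _ _ hμ hμ']
    change CycEnvelope.muConjClass (T.level M).augY (T.level M).chi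
        ((T.level M).sAlg.range.map ((T.level M).conjX g).toMonoidHom) = _
    rw [T.map_range_sAlg_conjX M g]

/-! ## Corollary 2.16 -/

/-- **Corollary 2.16 (Profinite Non-discreteness of Bi-theta Environments) — DISCHARGED modulo
`Π^tp_Ÿ ↠ G_K` and the bi-theta symmetry clause of Prop 2.14 (iii)** (in cocycle form: the conjugate
of a mod-`M` theta cocycle by `x ∈ Π^tp_X` with `M ∣ [x̄] ∈ Gal(Y/X) ≅ ℤ` differs from it by a
coboundary). For every compatible family `η` and every `j_∞ = (j_M)_M ∈ lim ℤ/Mℤ` the projective system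
`γ_{M',M} := conj(x₁^{k_{M'}−k_M}) ∘ β_{M',M}` (`x₁` a generator of `Gal(Y/X)` with `aug x₁ = 1`,
`k_M ≡ j_M (mod M)`, `k_1 = 0`) has the properties (a), (b) of the named fact `ThetaEnvTower.Cor216`.
[cite: MochizukiEtTh2009, Cor 2.16 p.53] -/
theorem cor216_of (haug : Function.Surjective (T.aug.comp T.PiYdd.subtype))
    (hshift : ∀ (M : E) (η : T.PiYdd → T.mu M), η ∈ T.thetaCocycles M → ∀ x : T.PiX,
      ((M : ℕ+) : ℤ) ∣ Multiplicative.toAdd (T.galYX (QuotientGroup.mk x)) →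
      ∃ c : T.mu M, T.conjCocycle M x η =
        η * CycEnvelope.coboundary (T.aug.comp T.PiYdd.subtype) (T.chi M) c) :
    T.Cor216 := by
  haveI : T.PiY.Normal := T.PiY_normal
  intro η hη _ j hj
  -- a generator `x₁` of `Gal(Y/X) ≅ ℤ` with trivial image in `G_K` (possible since `Π^tp_Ÿ ↠ G_K`)
  obtain ⟨x₁, hx₁, haug₁⟩ : ∃ x₁ : T.PiX,
      T.galYX (QuotientGroup.mk x₁) = Multiplicative.ofAdd (1 : ℤ) ∧ T.aug x₁ = 1 := by
    obtain ⟨q, hq⟩ := QuotientGroup.mk_surjective (T.galYX.symm (Multiplicative.ofAdd (1 : ℤ)))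
    obtain ⟨y, hy⟩ := haug (T.aug q)⁻¹
    refine ⟨q * (y : T.PiX), ?_, ?_⟩
    · rw [QuotientGroup.mk_mul, (QuotientGroup.eq_one_iff (y : T.PiX)).mpr (T.PiYdd_le y.2), mul_one,
        hq, MulEquiv.apply_symm_apply]
    · rw [map_mul]
      change T.aug q * (T.aug.comp T.PiYdd.subtype) y = 1
      rw [hy, mul_inv_cancel]
  have hgal : ∀ a : ℤ, T.galYX (QuotientGroup.mk (x₁ ^ a)) = Multiplicative.ofAdd a := fun a => by
    rw [QuotientGroup.mk_zpow, map_zpow, hx₁, ← ofAdd_zsmul, smul_eq_mul, mul_one]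
  have haugx : ∀ a : ℤ, T.aug (x₁ ^ a) = 1 := fun a => by rw [map_zpow, haug₁, one_zpow]
  -- integer lifts `k_M ≡ j_M (mod M)` with `k_1 = 0`
  obtain ⟨k, hkj, hk1⟩ : ∃ k : E → ℤ,
      (∀ M : E, ((k M : ℤ) : ZMod (M : ℕ+)) = j M) ∧ k ⟨1, T.one_mem⟩ = 0 := by
    classical
    have hex : ∀ M : E, ∃ z : ℤ, (z : ZMod (M : ℕ+)) = j M := fun M => ZMod.intCast_surjective (j M)
    choose k₀ hk₀ using hex
    refine ⟨fun M => if ((M : ℕ+) : ℕ) = 1 then 0 else k₀ M, fun M => ?_, by simp⟩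
    by_cases hM : ((M : ℕ+) : ℕ) = 1
    · haveI := (ZMod.subsingleton_iff (n := ((M : ℕ+) : ℕ))).mpr hM
      exact Subsingleton.elim _ _
    · show ((if ((M : ℕ+) : ℕ) = 1 then (0 : ℤ) else k₀ M : ℤ) : ZMod (M : ℕ+)) = j M
      rw [if_neg hM]
      exact hk₀ M
  -- `M ∣ k_{M'} − k_M` for `M ∣ M'` (compatibility of `j`)
  have hdvd : ∀ (M M' : E), (M : ℕ+) ∣ M' → ((M : ℕ+) : ℤ) ∣ k M' - k M := by
    intro M M' h
    have h1 := hj M M' h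
    rw [← hkj M', ← hkj M, map_intCast] at h1
    exact (ZMod.intCast_eq_intCast_iff_dvd_sub (k M) (k M') (M : ℕ+)).mp h1.symm
  -- the projective system `γ`
  refine ⟨fun M M' h => ((T.level M).conjX (x₁ ^ (k M' - k M))).toMonoidHom.comp (T.redEnv M M' h),
    fun M M' h => ?_, fun M h x => ?_, fun M M' M'' h h' x => ?_, ?_⟩
  · -- (a) `γ_{M',M} = conj(x₁^{k_{M'}−k_M}) ∘ β_{M',M} ∘ id`, the conjugation an automorphism of `B_M`
    obtain ⟨c, hc⟩ := hshift M (η M) (hη M) (x₁ ^ (k M' - k M)) (by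
      rw [hgal]; exact hdvd M M' h)
    obtain ⟨α, hα⟩ := T.exists_biIso_conjX M (hη M) (x₁ ^ (k M' - k M)) c hc
    obtain ⟨α', hα'⟩ := T.exists_biIso_refl M' (hη M')
    exact ⟨α, α', fun x => by rw [hα', hα]; rfl⟩
  · -- `γ_{M,M} = id`
    change (T.level M).conjX (x₁ ^ (k M - k M)) (T.redEnv M M h x) = x
    rw [sub_self, zpow_zero, T.conjX_one M, MulAut.one_apply, T.redEnv_self]
  · -- `γ_{M'',M} = γ_{M',M} ∘ γ_{M'',M'}` (conjugations commute with reductions)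
    change (T.level M).conjX (x₁ ^ (k M'' - k M)) (T.redEnv M M'' (h.trans h') x) =
      (T.level M).conjX (x₁ ^ (k M' - k M)) (T.redEnv M M' h
        ((T.level M').conjX (x₁ ^ (k M'' - k M')) (T.redEnv M' M'' h' x)))
    rw [T.reduces_conjX h (x₁ ^ (k M'' - k M')) (T.redEnv M' M'' h' x), ← MulAut.mul_apply,
      ← ThetaEnvData.conjX_mul, ← zpow_add, ← T.redEnv_comp M M' M'' h h',
      show k M' - k M + (k M'' - k M') = k M'' - k M by ring]
  · -- (b) `x_M := x₁^{k_M}`, `ψ := conj(x_M)|_{Π^tp_Ÿ}`, `c := 1`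
    haveI : T.PiYdd.Normal := T.PiYdd_normal
    haveI : Subsingleton (T.mu ⟨1, T.one_mem⟩) :=
      Fintype.card_le_one_iff_subsingleton.mp (by rw [T.card_mu]; exact le_rfl)
    refine ⟨k, fun M => x₁ ^ k M, hkj, fun M => hgal (k M), fun M h1 => ?_⟩
    refine ⟨MulAut.conjNormal (x₁ ^ k M), 1, fun g => ?_, fun g => ?_⟩
    · -- `γ_{M,1}(s^Θ_M(g)) = s^alg_1(x_M g x_M⁻¹)`
      change (T.level ⟨1, T.one_mem⟩).conjX (x₁ ^ (k M - k ⟨1, T.one_mem⟩))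
          (T.redEnv ⟨1, T.one_mem⟩ M h1 ((T.level M).sTheta (hη M) g)) = _
      rw [hk1, sub_zero]
      ext
      · exact Subsingleton.elim _ _
      · change x₁ ^ k M * (g : T.PiX) * (x₁ ^ k M)⁻¹ = ((MulAut.conjNormal (x₁ ^ k M) g : T.PiYdd) : T.PiX)
        rw [MulAut.conjNormal_apply]
    · -- the transported difference cocycle is the `x_M`-conjugate of `η_M` (no coboundary needed)
      have hψ : (MulAut.conjNormal (x₁ ^ k M)).symm g = ⟨(x₁ ^ k M)⁻¹ * g * x₁ ^ k M, by
          simpa [mul_assoc] using T.PiYdd_normal.conj_mem _ g.2 (x₁ ^ k M)⁻¹⟩ :=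
        Subtype.ext (MulAut.conjNormal_symm_apply _ _)
      rw [hψ]
      simp only [ThetaEnvTower.conjCocycle, haugx, map_one, MulAut.one_apply, CycEnvelope.coboundary,
        inv_one, mul_one]

end ThetaEnvTower

end Literature.AnabelianGeometry.EtaleTheta
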